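/-
Copyright (c) 2026. All rights reserved.
Released under Apache 2.0 license as described in the file LICENSE.
Authors: abc-iut cell — seat abc-iut-w5-d226 (wave 5), over abc-iut-L4-t12's
`HolomorphicEllipticCuspidalization.lean` and the `ComplexTorus` library.
-/
import Literature.AnabelianGeometry.AbsoluteAnabelian.HolomorphicEllipticCuspidalization
import Literature.Geometry.Kaehler.ComplexTorusIsogenies
import Literature.Geometry.Kaehler.ComplexTorusDeckTransformations
import HarnessLib

/-!
# [AbsTopIII] Cor 2.7 (b), sub-node (b).1: `[N] : 𝕌_N → 𝔼` is finite étale — PROOF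

Sub-DAG `plan/L4/SUBDAG-AbsTopIII-Cor-27.md`, row Cor-27.b.r5, first half: the named statement
`HolomorphicEllipticCuspidalization.NsmulCovIsFiniteEtale` of abc-iut-L4-t12's statements file
(p414370) — for every one-dimensional complex torus `T = ℂ/Φ(ℤ^ι)` and `N ≠ 0`, the multiplication map
`[N] : 𝕌_N = T ∖ T[N] → 𝔼 = T ∖ {0}` "is an abelian finite étale covering" ([AbsTopIII] Cor 2.7 (b) p.59
l.7, quoting [AbsTopII] Example 3.2 (i): "the morphism `[N]_E : E → E` given by multiplication by `N`
determines a finite étale covering `[N]_D : U → D` [of degree `N²`]") — in the tree's sense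
`IsFiniteEtale` (a covering map with finite fibres, `AutHolomorphicSpaces.lean`).

Proof-only (kind=proof; no new notions): `[N] = ρ(N·1)` is an isogeny (`ComplexTorus.isIsogeny_smul_one`),
hence a covering map of the torus (`ComplexTorus.IsIsogeny.isCoveringMap'`); covering maps restrict to
preimages of subsets (Mathlib `IsCoveringMap.restrictPreimage`), and `𝕌_N = [N]⁻¹(𝔼)` by definition; the
fibres are translates of the finite kernel `T[N]`.  Bib key `MochizukiAbsTopIII2015`.  Refereed
classical material; nothing here bears on the disputed [IUTchIII] Cor. 3.12.
-/

namespace Literature.AnabelianGeometry.AbsoluteAnabelian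

namespace HolomorphicEllipticCuspidalization

open _root_.TopologicalSpace _root_.Topology
open Literature.Geometry.Kaehler (ComplexTorus)
open Literature.Geometry.Kaehler.ComplexTorus

section

variable {ι : Type} [Fintype ι] (Φ : (ι → ℝ) ≃L[ℝ] ℂ)

/-- Multiplication by `N` on the torus is the homomorphism `ρ(N • 1)` of the `ComplexTorus` library.
[cite: MochizukiAbsTopIII2015, Corollary 2.7 (b) p.59] -/
theorem mapMatrix_natCast_smul_one [DecidableEq ι] (N : ℕ) (x : ComplexTorus Φ) :
    mapMatrix Φ Φ ((N : ℤ) • (1 : Matrix ι ι ℤ)) x = N • x := by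
  rw [mapMatrix_smul, mapMatrix_one, natCast_zsmul]

/-- **Multiplication by `N ≠ 0` is a covering map of the torus** (an isogeny is a covering map).
[cite: MochizukiAbsTopIII2015, Corollary 2.7 (b) p.59] -/
theorem isCoveringMap_nsmul {N : ℕ} (hN : N ≠ 0) :
    IsCoveringMap (fun x : ComplexTorus Φ => N • x) := by
  classical
  have hiso : IsIsogeny Φ Φ ((N : ℤ) • (1 : Matrix ι ι ℤ)) :=
    isIsogeny_smul_one Φ (by exact_mod_cast hN)
  have hfun : mapMatrix Φ Φ ((N : ℤ) • (1 : Matrix ι ι ℤ)) = fun x : ComplexTorus Φ => N • x :=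
    funext (mapMatrix_natCast_smul_one Φ N)
  rw [← hfun]
  exact hiso.isCoveringMap'

/-- **The fibres of multiplication by `N ≠ 0` are finite** (translates of the finite kernel `T[N]`).
[cite: MochizukiAbsTopIII2015, Corollary 2.7 (b) p.59] -/
theorem finite_preimage_nsmul_singleton {N : ℕ} (hN : N ≠ 0) (t : ComplexTorus Φ) :
    ((fun x : ComplexTorus Φ => N • x) ⁻¹' {t}).Finite := by
  classical
  have hiso : IsIsogeny Φ Φ ((N : ℤ) • (1 : Matrix ι ι ℤ)) :=
    isIsogeny_smul_one Φ (by exact_mod_cast hN)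
  haveI := hiso.finite_ker
  have hK : ((mapMatrixHom Φ Φ ((N : ℤ) • (1 : Matrix ι ι ℤ))).ker : Set (ComplexTorus Φ)).Finite :=
    Set.toFinite _
  by_cases hne : ((fun x : ComplexTorus Φ => N • x) ⁻¹' {t}).Nonempty
  · obtain ⟨x₀, hx₀⟩ := hne
    have hx₀' : N • x₀ = t := hx₀
    refine (hK.image fun k => k + x₀).subset ?_
    intro x hx
    have hx' : N • x = t := hx
    refine ⟨x - x₀, ?_, sub_add_cancel x x₀⟩
    change x - x₀ ∈ (mapMatrixHom Φ Φ ((N : ℤ) • (1 : Matrix ι ι ℤ))).ker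
    rw [AddMonoidHom.mem_ker, map_sub, mapMatrixHom_apply, mapMatrixHom_apply,
      mapMatrix_natCast_smul_one, mapMatrix_natCast_smul_one, hx', hx₀', sub_self]
  · rw [Set.not_nonempty_iff_eq_empty.mp hne]
    exact Set.finite_empty

/-- **Cor 2.7 (b), sub-node (b).1 for the model `[N]`-diagram**: `[N] : 𝕌_N → 𝔼` is finite étale.
[cite: MochizukiAbsTopIII2015, Corollary 2.7 (b) p.59] -/
theorem isFiniteEtale_nsmulCov {N : ℕ} (hN : N ≠ 0) : IsFiniteEtale (nsmulCov Φ N) := by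
  refine ⟨?_, fun y => ?_⟩
  · exact (isCoveringMap_nsmul Φ hN).restrictPreimage (puncturedTorus Φ : Set (ComplexTorus Φ))
  · refine ((finite_preimage_nsmul_singleton Φ hN (y : ComplexTorus Φ)).preimage
      Subtype.val_injective.injOn).subset ?_
    intro x hx
    have hx' : nsmulCov Φ N x = y := hx
    change N • (x : ComplexTorus Φ) = (y : ComplexTorus Φ)
    rw [← hx']
    rfl

end

/-- **`NsmulCovIsFiniteEtale` HOLDS** (sub-DAG Cor-27, row b.r5 (b).1; FQ-typed closing theorem).
[cite: MochizukiAbsTopIII2015, Corollary 2.7 (b) p.59] -/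
theorem nsmulCovIsFiniteEtale_holds :
    Literature.AnabelianGeometry.AbsoluteAnabelian.HolomorphicEllipticCuspidalization.NsmulCovIsFiniteEtale :=
  fun _ι _ Φ _N hN => isFiniteEtale_nsmulCov Φ hN

/-- `NsmulCovIsFiniteEtale` — `_holds` alias of `nsmulCovIsFiniteEtale_holds` above under the fact's exact name (appended
2026-08-28, D-0026 bookkeeping: the proof term is the existing theorem of this file; no statement,
definition or attribute is edited; no new named fact; the ledger's debt table listed the fact
unproved). [cite: MochizukiAbsTopIII2015, Corollary 2.7 (b) p.59] -/
theorem _root_.Literature.AnabelianGeometry.AbsoluteAnabelian.HolomorphicEllipticCuspidalization.NsmulCovIsFiniteEtale_holds :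
    Literature.AnabelianGeometry.AbsoluteAnabelian.HolomorphicEllipticCuspidalization.NsmulCovIsFiniteEtale :=
  _root_.Literature.AnabelianGeometry.AbsoluteAnabelian.HolomorphicEllipticCuspidalization.nsmulCovIsFiniteEtale_holds

end HolomorphicEllipticCuspidalization

end Literature.AnabelianGeometry.AbsoluteAnabelian
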